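import Summits.CriticalPhenomena.SAWScalingLimit.Theorems.SAWDevelopingMapHexTransferPortDictionaryYB
import Summits.CriticalPhenomena.SAWScalingLimit.Theses.SAWCompassLattice
import Mathlib.Combinatorics.SimpleGraph.Paths
import HarnessLib

/-!
# Port dictionary (item stmt-CriticalPhenomena-6966 `SAWCompassLattice.PortDictionary`), part 6:
# from walks to vertex lists, and the stub `stub_portDictionary`

Stub `stub_portDictionary` of line `Sketch` of crux stmt-CriticalPhenomena-14221 (`HexTransfer`);
concludes parts 1–5 (`…PortDictionaryGadget/Weights/Segments/Sums/YB`).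

* `tsum_walks_eq` : the item's sum over simple paths of the compass graph with prescribed port
  sequence is the sum over the compass vertex lists (`Walk.support` is a bijection onto
  `compassLists`, and the item's `wt` is `wtL` of the support);
* `Compass.portDictionary` : the dictionary for any `Compass` structure satisfying the three
  compass equations — the compass sum is `ofReal (Psi)` (part 4), which is the Glazman–Manolescu
  weight of the unique Yang–Baxter walk with these mid-edges (part 5), or there is no such walk
  and no compass path;
* `stub_portDictionary` : the item verbatim, by instantiating `Compass` with the item's
  `G = fromRel R`, `y`, `(α, β, s, z)`.
-/

namespace Summit.CriticalPhenomena.SAWScalingLimit.Cruxes.HexTransfer.Sketch.PortDict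

open Literature.Probability.RandomPlanarGeometry.SAW.YangBaxter
open scoped ENNReal

namespace Compass

variable (C : Compass) {Δ : Set Face} {a b : MidEdge} {ms : List MidEdge}

/-- The item's `wt` (product of dart weights) is `wtL` of the support. -/
theorem prod_darts_eq_wtL {u v : V} (p : C.G.Walk u v) :
    (p.darts.map fun d => C.y d.fst d.snd).prod = C.wtL p.support := by
  induction p with
  | nil => simp
  | cons h p ih =>
    rw [SimpleGraph.Walk.darts_cons, List.map_cons, List.prod_cons, SimpleGraph.Walk.support_cons, ih,
      ← p.cons_tail_support]
    rfl

/-- A walk is determined by its support. -/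
theorem walk_eq_of_support_eq {u v : V} : ∀ (p q : C.G.Walk u v), p.support = q.support → p = q := by
  intro p
  induction p with
  | nil =>
    intro q h
    cases q with
    | nil => rfl
    | cons h' q' => simp at h
  | @cons u' w v' h p' ih =>
    intro q hq
    cases q with
    | nil => simp at hq
    | @cons _ w' _ h' q' =>
      simp only [SimpleGraph.Walk.support_cons, List.cons.injEq, true_and] at hq
      obtain rfl : w = w' := by
        have h1 := congrArg List.head? hq
        rwa [List.head?_eq_some_head p'.support_ne_nil, List.head?_eq_some_head q'.support_ne_nil,
          SimpleGraph.Walk.head_support, SimpleGraph.Walk.head_support, Option.some_inj] at h1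
      rw [ih q' hq]

variable (Δ a b ms) in
/-- **From walks to lists.** The item's sum over the simple paths `inl a → inl b` of the compass
graph through gadgets of faces of `Δ` with port sequence `ms` equals the sum of `wtL` over
`compassLists` (nothing used beforehand). -/
theorem tsum_walks_eq :
    ∑' p : {p : C.G.Walk (Sum.inl a) (Sum.inl b) // p.IsPath ∧
        (∀ v ∈ p.support, ∀ (f : Face) (q : Fin 3 × Fin 4), v = Sum.inr (f, q) → f ∈ Δ) ∧
        p.support.filterMap Sum.getLeft? = ms},
      ENNReal.ofReal ((p.1.darts.map fun d => C.y d.fst d.snd).prod) =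
    ∑' l : C.compassLists Δ (fun _ => []) a b ms, ENNReal.ofReal (C.wtL l) := by
  classical
  let F : {p : C.G.Walk (Sum.inl a) (Sum.inl b) // p.IsPath ∧
        (∀ v ∈ p.support, ∀ (f : Face) (q : Fin 3 × Fin 4), v = Sum.inr (f, q) → f ∈ Δ) ∧
        p.support.filterMap Sum.getLeft? = ms} → C.compassLists Δ (fun _ => []) a b ms := fun p =>
    ⟨p.1.support, by
      refine ⟨?_, ?_, p.1.isChain_adj_support, p.2.1.support_nodup, fun f q h => p.2.2.1 _ h f q rfl,
        p.2.2.2, fun f q _ => List.not_mem_nil⟩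
      · rw [List.head?_eq_some_head p.1.support_ne_nil, p.1.head_support]
      · rw [List.getLast?_eq_some_getLast p.1.support_ne_nil, p.1.getLast_support]⟩
  have hF : Function.Bijective F := by
    constructor
    · intro p q h
      exact Subtype.ext (C.walk_eq_of_support_eq _ _ (congrArg Subtype.val h))
    · rintro ⟨l, h1, h2, h3, h4, h5, h6, -⟩
      have hne : l ≠ [] := by rintro rfl; simp at h1
      have hu : l.head hne = Sum.inl a := by
        rw [List.head?_eq_some_head hne, Option.some_inj] at h1; exact h1
      have hv : l.getLast hne = Sum.inl b := by
        rw [List.getLast?_eq_some_getLast hne, Option.some_inj] at h2; exact h2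
      have hsupp : ((SimpleGraph.Walk.ofSupport l hne h3).copy hu hv).support = l := by
        rw [SimpleGraph.Walk.support_copy, SimpleGraph.Walk.support_ofSupport]
      refine ⟨⟨(SimpleGraph.Walk.ofSupport l hne h3).copy hu hv, ?_, ?_, ?_⟩, Subtype.ext hsupp⟩
      · rw [SimpleGraph.Walk.isPath_def, hsupp]; exact h4
      · rw [hsupp]; rintro v hv f q rfl; exact h5 f q hv
      · rw [hsupp]; exact h6
  rw [← (Equiv.ofBijective F hF).tsum_eq]
  refine tsum_congr fun p => ?_
  rw [Equiv.ofBijective_apply, C.prod_darts_eq_wtL]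

variable (Δ a b ms) in
/-- **The port dictionary for a `Compass` structure.** Under the three compass equations, the
`wtL`-sum over the compass lists from `a` to `b` with port sequence `ms` is the Glazman–Manolescu
weight (at `θ = π/2`) of the Yang–Baxter walk of `Δ` with mid-edges `ms` — both sides `0` if there
is none. -/
theorem portDictionary_lists (hU : C.z ^ 2 * Tadj C.α C.β C.s = weightU1 (Real.pi / 2))
    (hV : C.z ^ 2 * Topp C.α C.β C.s = weightV (Real.pi / 2))
    (hW : C.z ^ 4 * Dpair C.α C.β C.s = weightW1 (Real.pi / 2)) :
    ∑' l : C.compassLists Δ (fun _ => []) a b ms, ENNReal.ofReal (C.wtL l) =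
      ∑' γ : {γ : YBWalk Δ a b // γ.mids = ms}, ENNReal.ofReal (γ.1.weight fun _ => Real.pi / 2) := by
  classical
  by_cases hex : ∃ γ : YBWalk Δ a b, γ.mids = ms
  · -- the walk exists: both sides are its weight
    obtain ⟨γ, rfl⟩ := hex
    rw [tsum_eq_single (⟨γ, rfl⟩ : {γ' : YBWalk Δ a b // γ'.mids = γ.mids})
      fun γ' hne => absurd (Subtype.ext (YBWalk.ext γ'.2)) hne]
    change _ = ENNReal.ofReal (γ.weight fun _ => Real.pi / 2)
    obtain ⟨ms', hms⟩ : ∃ ms', γ.mids = a :: ms' := List.head?_eq_some_iff.1 γ.head_eq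
    have hnd := γ.nodup
    have hlast := γ.getLast_eq
    have harcs := γ.arc_mem
    rw [hms] at hnd hlast harcs ⊢
    rw [C.tsum_compassLists Δ b ms' a (fun _ => []) hnd hlast harcs, ← hms, C.Psi_eq_weight hU hV hW γ]
  · -- no walk: no compass list of non-zero total weight
    haveI : IsEmpty {γ : YBWalk Δ a b // γ.mids = ms} := ⟨fun γ => hex ⟨γ.1, γ.2⟩⟩
    rw [(tsum_empty : ∑' γ : {γ : YBWalk Δ a b // γ.mids = ms},
      ENNReal.ofReal (γ.1.weight fun _ => Real.pi / 2) = 0)]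
    refine ENNReal.tsum_eq_zero.2 ?_
    rintro ⟨l, hl⟩
    have hhead := head?_eq_of_mem_compassLists hl
    obtain ⟨ms', rfl⟩ := List.head?_eq_some_iff.1 hhead
    by_cases hadm : (a :: ms').Nodup ∧ (a :: ms').getLast? = some b ∧
        ∀ p ∈ arcsOf (a :: ms'), ∃ f ∈ Δ, arcFace p = some f
    · have hPsi : Psi C (fun _ => []) (a :: ms') = 0 := by
        by_contra hne
        exact hex (C.exists_ybWalk hadm.1 hadm.2.1 hadm.2.2 hne)
      have hsum := C.tsum_compassLists Δ b ms' a (fun _ => []) hadm.1 hadm.2.1 hadm.2.2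
      rw [hPsi, ENNReal.ofReal_zero, ENNReal.tsum_eq_zero] at hsum
      exact hsum ⟨l, hl⟩
    · have := C.compassLists_eq_empty Δ b ms' a (fun _ => []) hadm
      rw [this] at hl
      exact hl.elim

variable (Δ a b ms) in
/-- **The port dictionary for a `Compass` structure, walk form.** -/
theorem portDictionary (hU : C.z ^ 2 * Tadj C.α C.β C.s = weightU1 (Real.pi / 2))
    (hV : C.z ^ 2 * Topp C.α C.β C.s = weightV (Real.pi / 2))
    (hW : C.z ^ 4 * Dpair C.α C.β C.s = weightW1 (Real.pi / 2)) :
    ∑' p : {p : C.G.Walk (Sum.inl a) (Sum.inl b) // p.IsPath ∧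
        (∀ v ∈ p.support, ∀ (f : Face) (q : Fin 3 × Fin 4), v = Sum.inr (f, q) → f ∈ Δ) ∧
        p.support.filterMap Sum.getLeft? = ms},
      ENNReal.ofReal ((p.1.darts.map fun d => C.y d.fst d.snd).prod) =
      ∑' γ : {γ : YBWalk Δ a b // γ.mids = ms}, ENNReal.ofReal (γ.1.weight fun _ => Real.pi / 2) := by
  rw [C.tsum_walks_eq Δ a b ms, C.portDictionary_lists Δ a b ms hU hV hW]

end Compass

end PortDict

/-! ## The stub -/

open Summit.CriticalPhenomena.SAWScalingLimit.Theses
open Literature.Probability.RandomPlanarGeometry.SAW.YangBaxter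

/-- **Port dictionary** (item stmt-CriticalPhenomena-6966 `SAWCompassLattice.PortDictionary`,
stub `stub_portDictionary` of line `Sketch` of crux stmt-CriticalPhenomena-14221): for every
solution `(α, β, s, z)` of the compass equations, every set of faces `Δ`, ports `a, b` and list
`ms` of mid-edges, the total weight of the compass self-avoiding paths from port `a` to port `b`
through gadgets of faces of `Δ` with port sequence `ms` equals the Glazman–Manolescu weight
`w_{π/2}(γ)` of the Yang–Baxter walk `γ` of `Δ` with `mids = ms` (both sides `0` if there is none). -/
theorem stub_portDictionary : SAWCompassLattice.PortDictionary := by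
  intro α β s z h cyc R G y wt Δ a b ms
  obtain ⟨hα, hβ, hs, -, hU, hV, hW⟩ := h
  have hlr : ∀ (e : MidEdge) (f : Face) (q : PortDict.Node),
      G.Adj (Sum.inl e) (Sum.inr (f, q)) ↔ q.1 = 0 ∧ f.side (PortDict.cyc q.2) = e := by
    intro e f q
    obtain ⟨l, i⟩ := q
    simp [G, R, SimpleGraph.fromRel_adj, PortDict.cyc, cyc]
  have hrr : ∀ (f : Face) (q : PortDict.Node) (f' : Face) (q' : PortDict.Node),
      G.Adj (Sum.inr (f, q)) (Sum.inr (f', q')) ↔ f = f' ∧ PortDict.adjB q q' = true := by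
    intro f q f' q'
    obtain ⟨l, i⟩ := q
    obtain ⟨l', i'⟩ := q'
    simp only [G, R, SimpleGraph.fromRel_adj, PortDict.adjB, PortDict.r0B, Bool.or_eq_true,
      decide_eq_true_eq]
    constructor
    · rintro ⟨hne, h | h⟩
      · exact ⟨h.1, Or.inl h.2⟩
      · exact ⟨h.1.symm, Or.inr h.2⟩
    · rintro ⟨rfl, h | h⟩
      · refine ⟨?_, Or.inl ⟨rfl, h⟩⟩
        intro heq
        simp only [Sum.inr.injEq, Prod.mk.injEq] at heq
        obtain ⟨-, rfl, rfl⟩ := heq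
        omega
      · refine ⟨?_, Or.inr ⟨rfl, h⟩⟩
        intro heq
        simp only [Sum.inr.injEq, Prod.mk.injEq] at heq
        obtain ⟨-, rfl, rfl⟩ := heq
        omega
  let C : PortDict.Compass :=
    { G := G, y := y, α := α, β := β, s := s, z := z, hα := hα.le, hβ := hβ.le, hs := hs.le
      adj_inl_inl := fun e e' => by simp [G, R, SimpleGraph.fromRel_adj]
      adj_inl_inr := hlr
      adj_inr_inr := hrr
      y_inl_inr := fun e x => by simp [y]
      y_inr_inl := fun x e => by simp [y]
      y_inr_inr := fun f q f' q' => by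
        obtain ⟨l, i⟩ := q
        obtain ⟨l', i'⟩ := q'
        simp [y, PortDict.edgeW] }
  exact C.portDictionary Δ a b ms hU hV hW

end Summit.CriticalPhenomena.SAWScalingLimit.Cruxes.HexTransfer.Sketch
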